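/-
Copyright (c) 2026. All rights reserved.
Released under Apache 2.0 license as described in the file LICENSE.
Authors: abc-iut cell — seat abc-iut-w4-d104 (gen 3): row «COR29-GLOBALISE» (L4-lead RULING #7e) —
[AbsTopIII] Cor 2.9 for the genuine datum `D : NFCurveData` under the chart-package hypothesis.
-/
import Literature.AnabelianGeometry.AbsoluteAnabelian.ArchimedeanReconstructionCor29ChartPackage
import Literature.AnabelianGeometry.AbsoluteAnabelian.ArchimedeanReconstructionCor29ChartPackageScalar
import HarnessLib

/-!
# [AbsTopIII] Cor 2.9 «Global-Archimedean Elliptically Admissible Compatibility» for the GENUINE datum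
# `D : NFCurveData`, under the chart-package hypothesis

S. Mochizuki, *Topics in absolute anabelian geometry III* (bib key `MochizukiAbsTopIII2015`), Cor 2.9,
kurims p.64 l.37 – p.65 l.34.  The statement of record `GlobalArchimedeanCompatibility D L …`
(`ArchimedeanReconstruction.lean`, p408225) is a schema over the Cor 2.8 interface `NFCurveData` whose
universal closure is FALSE (p428019: at junk parameters, e.g. `fval := 1`, clause (a) fails); its instance
form is abc-iut-w5-d225's junction `NFCurveData.globalArchimedeanCompatibility_of_refined` from the refined
rows `NFCurveData.Cor29Refined` (p414208), proved so far only at MODELS (plane p414668; chart-transported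
planar disc p431893/p433149).  This PROOF-ONLY file proves the refined rows — hence the statement of record
— for the GENUINE datum `D`, under the ONE honest hypothesis the abstract datum lacks, stated as explicit
binders (no named `Prop` fact):

**chart-package hypothesis** — at every NF-point `x` of `X^top = X_v(k_v)`: an open `W_x ∋ x` and a chart
`e_x : W_x ⥲ B(e_x x, r_x) ⊆ ℂ` with inverse `e'_x` (for the genuine `X_v` these are the Cor 2.8 (b) charts
`f_U : U_X ⥲ U_v ⊆ k_v` shrunk to balls and read through `κ`); chart expressions `G x f : ℂ → ℂ` of the
values `fval f` of the NF-rational functions `f` vanishing at `x` (`κ⁻¹ ∘ fval f = G x f ∘ e_x` near `x`,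
`G x f` complex-differentiable at `e_x x`, `fval f x = 0`); a uniformiser among them (some such `f` with
`(G x f)′(e_x x) ≠ 0` — the span input of row 0.r5); and an identification `κ : ℂ ≃+* k_v` of topological
fields (print p.64: `k_v`, the completion at the archimedean `v`, `≅ ℂ`; NOT derivable from the interface —
the witness datum `D₂` of p428019 has `k_v = ℝ`).

* `NFCurveData.cor29Refined_of_chartPackage` — all refined rows (0.r5, a.r1–a.r6, b.r1/b.r2, b.r4, junk
  convention) for `𝒜_x := germAut 0` in the chart centred at `x` (`planeStructure.comap (fun _ ↦ 0)`),
  `ω_x := k_v`, `df|_x := κ((G x f)′(e_x x))`, the transported `+ₓ`, `(1/n)·ₓ`, `ι_x`, and the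
  chart-conjugated action of `𝒜_x`;
* `NFCurveData.globalArchimedeanCompatibility_of_chartPackage` — the statement of record for `D`.

SCHEMA REMARK (one line, no refutation needed): without the chart package, S4/S5 fail at junk parameters of
the same datum (p428019's reading `vanishesAt := ⊤, fval := 1`), which is exactly why the hypothesis is named.
HONEST SCOPE: hypothesis named, not discharged (it is the analytic structure of `X_v(k_v)`, owed by L4-t1's
Thm 1.9 output); functoriality (p.65 l.30–31) record-only; refereed pre-IUT material; nothing here bears on
the disputed [IUTchIII] Cor. 3.12; typed ≠ endorsed.
-/

noncomputable section

namespace Literature.AnabelianGeometry.AbsoluteAnabelian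

open _root_.Set _root_.Topology _root_.Filter _root_.Metric _root_.Function

/-! ## Cor 2.9 for the genuine datum `D : NFCurveData` under the chart-package hypothesis -/

namespace ArchimedeanReconstruction

open Cor29 Cor29ChartPackage

/-- The units part of a ring isomorphism `κ : ℂ ≃+* k_v` of topological fields, as an isomorphism of
topological groups `ℂ^× ≃ k_v^×`. (Auxiliary construction inside proofs only.)
[cite: MochizukiAbsTopIII2015, Corollary 2.9 (b) p.65] -/
theorem exists_unitsEquiv {𝕜 : Type*} [NontriviallyNormedField 𝕜] (κ : ℂ ≃+* 𝕜) (hκ : Continuous κ)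
    (hκ' : Continuous κ.symm) : ∃ κu : ℂˣ ≃ₜ* 𝕜ˣ, ∀ c : ℂˣ, ((κu c : 𝕜ˣ) : 𝕜) = κ c := by
  refine ⟨{ Units.mapEquiv κ.toMulEquiv with
    continuous_toFun := ?_, continuous_invFun := ?_ }, fun c => rfl⟩
  · show Continuous (Units.map (κ : ℂ →* 𝕜))
    exact Continuous.units_map _ hκ
  · show Continuous (Units.map (κ.symm : 𝕜 →* ℂ))
    exact Continuous.units_map _ hκ'

open Classical in
/-- **[AbsTopIII] Cor 2.9 for the GENUINE datum, refined rows** (`NFCurveData.Cor29Refined`) under the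
CHART-PACKAGE HYPOTHESIS — the one honest input the abstract datum `D : NFCurveData` lacks: at every NF-point
`x` of `X^top = X_v(k_v)` a chart `e_x : W_x ⥲ B(e_x x, r_x) ⊆ ℂ` (inverse `e'_x`; for the genuine `X_v` these
are the Cor 2.8 (b) charts `f_U` shrunk to balls, read through `κ`), chart expressions `G x f` of the values
`fval f` of the NF-rational functions vanishing at `x` (complex-differentiable at `e_x x`, `fval f x = 0`), a
uniformiser among them (`(G x f)′ ≠ 0` for some such `f` — the span input of row 0.r5), and an identification
`κ : ℂ ≃ k_v` of topological fields (print: `k_v ≅ ℂ` non-canonically; not derivable from the interface).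
The rows hold for: `𝒜_x := germAut 0` read in the chart centred at `x` (`planeStructure.comap (fun _ ↦ 0)`),
`ω_x := k_v`, `df|_x := κ((G x f)′(e_x x))`, `a +ₓ b := e_x⁻¹(e_x a + e_x b − e_x x)`,
`(1/n)·ₓ v := e_x⁻¹(e_x x + (e_x v − e_x x)/n)` on `U_x = {v ∈ W_x | ‖e_x v − e_x x‖ < r_x/2}` (junk `x` off
`U_x`), `u · v := e_x⁻¹(e_x x + c_u (e_x v − e_x x))`.
[cite: MochizukiAbsTopIII2015, Corollary 2.9 pp.64–65] -/
theorem NFCurveData.cor29Refined_of_chartPackage (D : NFCurveData) (isNFPoint : D.Xtop → Prop)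
    (W : D.Xtop → Set D.Xtop) (e : D.Xtop → D.Xtop → ℂ) (e' : D.Xtop → ℂ → D.Xtop) (r : D.Xtop → ℝ)
    (hr : ∀ x, isNFPoint x → 0 < r x) (hW : ∀ x, isNFPoint x → IsOpen (W x) ∧ x ∈ W x)
    (he : ∀ x, isNFPoint x → ContinuousOn (e x) (W x) ∧ MapsTo (e x) (W x) (ball (e x x) (r x)))
    (he' : ∀ x, isNFPoint x →
      ContinuousOn (e' x) (ball (e x x) (r x)) ∧ MapsTo (e' x) (ball (e x x) (r x)) (W x))
    (hl : ∀ x, isNFPoint x → ∀ v ∈ W x, e' x (e x v) = v)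
    (hrt : ∀ x, isNFPoint x → ∀ w ∈ ball (e x x) (r x), e x (e' x w) = w)
    (fval : D.Fn → D.Xtop → D.kv) (vanishesAt : D.Fn → D.Xtop → Prop) (G : D.Xtop → D.Fn → ℂ → ℂ)
    (κ : ℂ ≃+* D.kv) (hκ : Continuous κ) (hκ' : Continuous κ.symm)
    (hG : ∀ x, isNFPoint x → ∀ f, vanishesAt f x → DifferentiableAt ℂ (G x f) (e x x) ∧
      (∀ᶠ u in 𝓝 x, κ.symm (fval f u) = G x f (e x u)) ∧ fval f x = 0)
    (hvan : ∀ f x, vanishesAt f x → fval f x = 0)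
    (hspan : ∀ x, isNFPoint x → ∃ f, vanishesAt f x ∧ deriv (G x f) (e x x) ≠ 0) :
    D.Cor29Refined (Cor29Model.planeStructure.comap (fun _ : D.Xtop => (0 : ℂ))) isNFPoint
      (fun _ => D.kv) (fun x f => κ (deriv (G x f) (e x x))) vanishesAt
      (fun x a b => e' x (e x a + e x b - e x x))
      (fun x n v => if v ∈ W x ∧ ‖e x v - e x x‖ < r x / 2 then e' x (e x x + (e x v - e x x) / (n : ℂ)) else x)
      fval
      (fun x u v => e' x (e x x +
        (((Cor29Model.mult 0 : (Cor29Model.planeStructure.comap (fun _ : D.Xtop => (0 : ℂ))).A x ≃ₜ* ℂˣ) u :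
          ℂˣ) : ℂ) * (e x v - e x x))) := by
  obtain ⟨κu, hκu⟩ := exists_unitsEquiv κ hκ hκ'
  refine ⟨fun x hx => ?_, hvan, ?_⟩
  · -- row 0.r5: the differentials span `ω_x = k_v`
    intro ω
    obtain ⟨f, hf, hd⟩ := hspan x hx
    refine ⟨f, ω / κ (deriv (G x f) (e x x)), hf, ?_⟩
    have hne : κ (deriv (G x f) (e x x)) ≠ 0 := by rwa [map_ne_zero_iff κ κ.injective]
    simp only [smul_eq_mul, div_mul_cancel₀ _ hne]
  · refine ⟨fun x => {v | v ∈ W x ∧ ‖e x v - e x x‖ < r x / 2},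
      fun x v => (κ (e x v - e x x)) • (LinearMap.id : D.kv →ₗ[D.kv] D.kv),
      fun x => ((Cor29Model.mult 0 :
        (Cor29Model.planeStructure.comap (fun _ : D.Xtop => (0 : ℂ))).A x ≃ₜ* ℂˣ).trans κu),
      fun x hx => ?_, fun x₁ x₂ _ _ => scalarCompatibleWithTrans_pkg κu x₁ x₂⟩
    obtain ⟨hWo, hxW⟩ := hW x hx
    obtain ⟨hec, hem⟩ := he x hx
    obtain ⟨he'c, he'm⟩ := he' x hx
    refine ⟨isLocalAddDatumAt_pkg (hr x hx) hWo hxW hec he'c he'm (hl x hx) (hrt x hx),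
      iotaComputesLimits_pkg κ hκ (hr x hx) hxW he'c (hl x hx) (hrt x hx) (hG x hx),
      iotaIsEmbedding_pkg κ hκ hκ' hec he'c hem (hl x hx) (fun v hv => hv.1),
      iotaAdditive_pkg κ (hr x hx) (hrt x hx), iota_self_pkg κ,
      scalarFieldIso_pkg κ κu hκu (hr x hx) hWo hxW hec hem he'c he'm (hl x hx) (hrt x hx),
      fun v hv n => scale_of_not_mem hv n⟩

open Classical in
/-- **[AbsTopIII] Cor 2.9 «Global-Archimedean Elliptically Admissible Compatibility» — the statement of
record `GlobalArchimedeanCompatibility` for the GENUINE datum `D : NFCurveData`** under the chart-package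
hypothesis, by abc-iut-w5-d225's junction `NFCurveData.globalArchimedeanCompatibility_of_refined`.
HONEST SCOPE: the hypothesis (charts of `X^top` valued in `ℂ ≅ k_v`, chart expressions of the NF-rational
functions, a uniformiser at each NF-point) is NAMED, not discharged — it is what L4-t1's Thm 1.9 output /
the analytic structure of `X_v(k_v)` supplies; functoriality (p.65 l.30–31) stays record-only; refereed
pre-IUT material; nothing here bears on the disputed [IUTchIII] Cor. 3.12.
[cite: MochizukiAbsTopIII2015, Corollary 2.9 pp.64–65] -/
theorem NFCurveData.globalArchimedeanCompatibility_of_chartPackage (D : NFCurveData)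
    (isNFPoint : D.Xtop → Prop)
    (W : D.Xtop → Set D.Xtop) (e : D.Xtop → D.Xtop → ℂ) (e' : D.Xtop → ℂ → D.Xtop) (r : D.Xtop → ℝ)
    (hr : ∀ x, isNFPoint x → 0 < r x) (hW : ∀ x, isNFPoint x → IsOpen (W x) ∧ x ∈ W x)
    (he : ∀ x, isNFPoint x → ContinuousOn (e x) (W x) ∧ MapsTo (e x) (W x) (ball (e x x) (r x)))
    (he' : ∀ x, isNFPoint x →
      ContinuousOn (e' x) (ball (e x x) (r x)) ∧ MapsTo (e' x) (ball (e x x) (r x)) (W x))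
    (hl : ∀ x, isNFPoint x → ∀ v ∈ W x, e' x (e x v) = v)
    (hrt : ∀ x, isNFPoint x → ∀ w ∈ ball (e x x) (r x), e x (e' x w) = w)
    (fval : D.Fn → D.Xtop → D.kv) (vanishesAt : D.Fn → D.Xtop → Prop) (G : D.Xtop → D.Fn → ℂ → ℂ)
    (κ : ℂ ≃+* D.kv) (hκ : Continuous κ) (hκ' : Continuous κ.symm)
    (hG : ∀ x, isNFPoint x → ∀ f, vanishesAt f x → DifferentiableAt ℂ (G x f) (e x x) ∧
      (∀ᶠ u in 𝓝 x, κ.symm (fval f u) = G x f (e x u)) ∧ fval f x = 0)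
    (hvan : ∀ f x, vanishesAt f x → fval f x = 0)
    (hspan : ∀ x, isNFPoint x → ∃ f, vanishesAt f x ∧ deriv (G x f) (e x x) ≠ 0) :
    GlobalArchimedeanCompatibility D (Cor29Model.planeStructure.comap (fun _ : D.Xtop => (0 : ℂ))) isNFPoint
      (fun _ => D.kv) (fun x f => κ (deriv (G x f) (e x x))) vanishesAt
      (fun x n v => if v ∈ W x ∧ ‖e x v - e x x‖ < r x / 2 then e' x (e x x + (e x v - e x x) / (n : ℂ)) else x)
      fval :=
  D.globalArchimedeanCompatibility_of_refined _ _ _ _ _ _ _ _ _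
    (D.cor29Refined_of_chartPackage isNFPoint W e e' r hr hW he he' hl hrt fval vanishesAt G κ hκ hκ' hG
      hvan hspan)

end ArchimedeanReconstruction

end Literature.AnabelianGeometry.AbsoluteAnabelian

end
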